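import Literature.Probability.RandomPlanarGeometry.ChordalCurveFamily
import Literature.Probability.RandomPlanarGeometry.MarkedDomainCorners
import Literature.Topology.PlaneTopology.UniformLocalConnectedness
import HarnessLib

/-!
# Hull complements of a Dobrushin domain (one-sided hulls attached to a boundary arc)

Topic `Literature/Probability/RandomPlanarGeometry` (definition item `defn-DobrushinDomain.IsHullComplement`,
wanted by route `CriticalPhenomena/SAWScalingLimit/SAWPoissonBanks`, items stmt-CriticalPhenomena-4776…4779,
which INLINE the five-clause condition below verbatim).

For a Dobrushin domain `(D; a, b)` (`a = D.pt 0`, `b = D.pt 1`; arcs `D.arc 0`, `D.arc 1` between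
`a` and `b`) and a side `j : Fin 2`, `D.IsHullComplement j D'` says that the Dobrushin domain `D'` is
obtained from `D` by removing a hull attached to the arc OPPOSITE to `D.arc j`: `D' ⊆ D`, same marked
points, the kept arc `D.arc j` lies in `∂D'`, and `D' = D` in small balls about `a` and `b`. This
transposes to Jordan domains the one-sided hulls of the half-plane — the `±`-hulls
`𝒬₊ = {A ∈ 𝒬* : A ∩ ℝ ⊂ (0, ∞)}` of [LSW] §2 ("`𝒬₊, 𝒬₋` are semigroups"; §8.1, right-sided
restriction) and Werner's standing convention [W] §4.1 "`H₊ ⊂ ℍ` simply connected such that `ℍ ∖ H₊`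
is bounded, and bounded away from the whole negative half-line": under a chordal uniformizing map
`(ℍ; 0, ∞) → (D; a, b)` taking `ℝ₋` onto `D.arc j` these `H₊` are the carriers of the hull
complements of `D` on side `j` (`isHullComplement_iff_disjoint_closure` is that sentence).

Contents (all proved): the definition (LITERALLY the inlined clause, so the route decls restate over
it by `Iff.rfl`) with projections; two equivalent forms — LOCAL COINCIDENCE along the kept arc
(`isHullComplement_iff_forall_exists_inter_ball_eq`: every `z ∈ D.arc j` has a ball on which `D' = D`;
the hard direction is Newman's theorem `JordanDomain.uniformlyLocallyConnected` plus
`MarkedDomain.exists_pos_forall_mem_arc_of_dist_lt`) and Werner's form (`closure (D ∖ D')` misses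
`D.arc j`); `IsHullComplement.exists_arc_eq` (the kept arc IS an arc of `D'`; sub-arc lemma
`arc_subset_of_isPreconnected`); and the semilattice API the route asks for: `isHullComplement_self`
(refl), `IsHullComplement.trans` (same side), `.map` (images under ANY plane homeomorphism, e.g.
`similarity c hc w`, `Complex.conjLIE.toHomeomorph`), `.inter` (meet), `.isHullSubdomain` (the body of
`MarkedDomain.IsHullSubdomain` of `ConformalRestrictionProofs`, unfolded; that file is not imported).
"Same side" in `trans` is the hypothesis `D.arc j ⊆ D'.arc k`, NOT `k = j`: loop orientation is not
encoded in `MarkedDomain`, so the kept arc may be `D'.arc 0` or `D'.arc 1`; `exists_arc_eq` gives `k`.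
Not here: the dictionary with `φ(ℍ ∖ A)`, `A ∈ 𝒬₊` (cf. `HullSubdomainPullback` for `𝒬*`).

References. [LSW] G. F. Lawler, O. Schramm, W. Werner, *Conformal restriction: the chordal case*,
J. Amer. Math. Soc. 16 (2003) 917–955, arXiv:math/0209343, §2, §8.1. [W] W. Werner, *Conformal
restriction and related questions*, Probab. Surveys 2 (2005) 145–190, arXiv:math/0307353, §4.1.
M. H. A. Newman, *Elements of the topology of plane sets of points* (1939), Ch. VI Thm. 14·1.
-/

open Set Metric

namespace Literature.Probability.RandomPlanarGeometry

/-! ### Elementary facts about the two arcs of a Dobrushin domain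
(`MarkedDomain.isPreconnected_arc` lives in `Percolation/SmirnovConformalProofs`; not imported.) -/

namespace DobrushinDomain

/-- An identity `s' ∩ t = s ∩ t` persists on subsets `t' ⊆ t`. [folklore] -/
theorem inter_eq_inter_of_subset {α : Type*} {s s' t t' : Set α} (h : s' ∩ t = s ∩ t)
    (ht : t' ⊆ t) : s' ∩ t' = s ∩ t' := by
  rw [← inter_eq_self_of_subset_right ht, ← inter_assoc, h, inter_assoc]

/-- An identity `s' ∩ B(z, ρ) = s ∩ B(z, ρ)` persists on smaller balls. [folklore] -/
theorem inter_ball_eq_of_le {s s' : Set ℂ} {z : ℂ} {ρ ρ' : ℝ}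
    (h : s' ∩ ball z ρ = s ∩ ball z ρ) (hle : ρ' ≤ ρ) : s' ∩ ball z ρ' = s ∩ ball z ρ' :=
  inter_eq_inter_of_subset h (ball_subset_ball hle)

/-- In a Dobrushin domain `(D; a, b)` both marked points lie on both arcs. [folklore] -/
theorem pt_mem_arc (D : DobrushinDomain) (i j : Fin 2) : D.pt i ∈ D.arc j :=
  D.pt_mem_arc_iff.2 (by revert i j; decide)

/-- Interior points of an arc of a Dobrushin domain are not marked points. [folklore] -/
theorem boundary_ne_pt (D : DobrushinDomain) {j : Fin 2} {t : ℝ}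
    (ht : t ∈ Ioo (D.mark j) (D.nextMark j)) (i : Fin 2) : D.boundary t ≠ D.pt i := by
  intro heq
  have hmem : D.pt i ∈ D.arc (j + 1) := D.pt_mem_arc i (j + 1)
  rw [← heq] at hmem
  exact D.boundary_not_mem_arc ((by decide : ∀ j : Fin 2, j + 1 ≠ j) j) ht hmem

/-- With two marked points each arc parameter interval is shorter than a period. [folklore] -/
theorem nextMark_lt_mark_add_one (E : DobrushinDomain) (k : Fin 2) : E.nextMark k < E.mark k + 1 := by
  by_cases hk : k.val + 1 < 2
  · rw [E.nextMark_of_lt k hk]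
    linarith [(E.mark_mem ⟨k.val + 1, hk⟩).2, (E.mark_mem k).1]
  · rw [E.nextMark_of_not_lt k hk]
    have hk0 : k ≠ 0 := by rintro rfl; exact hk (by decide)
    linarith [E.strictMono_mark (Fin.pos_of_ne_zero hk0)]

/-- The boundary loop of a Dobrushin domain is injective on each closed arc parameter interval
(it is injective on every period `[s, s + 1)`). [folklore] -/
theorem injOn_boundary_Icc (E : DobrushinDomain) (k : Fin 2) :
    InjOn E.boundary (Icc (E.mark k) (E.nextMark k)) :=
  (E.injOn_boundary_Ico (E.mark k)).mono (Icc_subset_Ico_right (E.nextMark_lt_mark_add_one k))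

/-- **Sub-arc lemma.** A connected subset of a boundary arc of a Dobrushin domain containing both
endpoints of the arc is the whole arc: removing an interior point `boundary s₀` splits the arc into
two closed pieces meeting only there, each missing one endpoint. [folklore] -/
theorem arc_subset_of_isPreconnected (E : DobrushinDomain) (k : Fin 2) {A : Set ℂ}
    (hA : IsPreconnected A) (hAk : A ⊆ E.arc k) (h0 : E.pt k ∈ A) (h1 : E.pt (k + 1) ∈ A) :
    E.arc k ⊆ A := by
  rintro _ ⟨s₀, hs₀, rfl⟩
  by_contra hw
  have hinj := E.injOn_boundary_Icc k
  have hlt := E.mark_lt_nextMark k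
  set C₁ : Set ℂ := E.boundary '' Icc (E.mark k) s₀
  set C₂ : Set ℂ := E.boundary '' Icc s₀ (E.nextMark k)
  have hcover : A ⊆ C₁ ∪ C₂ := fun z hz => by
    obtain ⟨u, hu, rfl⟩ := hAk hz
    rcases le_total u s₀ with hus | hus
    exacts [Or.inl ⟨u, ⟨hu.1, hus⟩, rfl⟩, Or.inr ⟨u, ⟨hus, hu.2⟩, rfl⟩]
  have hdisj : A ∩ (C₁ ∩ C₂) = ∅ := by
    refine eq_empty_of_forall_notMem fun z ⟨hzA, ⟨u, hu, hzu⟩, ⟨v, hv, hzv⟩⟩ => ?_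
    have huv : u = v := hinj ⟨hu.1, hu.2.trans hs₀.2⟩ ⟨hs₀.1.trans hv.1, hv.2⟩ (hzu.trans hzv.symm)
    rw [le_antisymm hu.2 (huv ▸ hv.1)] at hzu
    exact hw (hzu ▸ hzA)
  rcases (isPreconnected_iff_subset_of_disjoint_closed.1 hA) C₁ C₂
    (isCompact_Icc.image E.continuous_boundary).isClosed
    (isCompact_Icc.image E.continuous_boundary).isClosed hcover hdisj with hA₁ | hA₂
  · obtain ⟨u, hu, hue⟩ := hA₁ h1
    rw [← E.boundary_nextMark] at hue
    have := hinj ⟨hu.1, hu.2.trans hs₀.2⟩ ⟨hlt.le, le_rfl⟩ hue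
    have hs₀M : s₀ ≠ E.nextMark k := by rintro h; rw [h, E.boundary_nextMark] at hw; exact hw h1
    exact hs₀M (le_antisymm hs₀.2 (this ▸ hu.2))
  · obtain ⟨v, hv, hve⟩ := hA₂ h0
    have := hinj ⟨hs₀.1.trans hv.1, hv.2⟩ ⟨le_rfl, hlt.le⟩ hve
    have hs₀m : s₀ ≠ E.mark k := by rintro h; rw [h] at hw; exact hw h0
    exact hs₀m (le_antisymm (this ▸ hv.1) hs₀.1)

/-- `D'` is a **hull complement of the Dobrushin domain `(D; a, b)` on side `j`**: `D'` is obtained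
from `D` by removing a hull attached to the boundary arc opposite to `D.arc j` — a Dobrushin
sub-domain `D' ⊆ D` with the same marked points `a = D.pt 0`, `b = D.pt 1`, whose frontier contains
the kept arc `D.arc j`, and which agrees with `D` in small balls about `a` and `b`. Transposition to
Jordan domains of the one-sided hulls `𝒬₊`/`𝒬₋` of Lawler–Schramm–Werner (§2: `A ∈ 𝒬*` with
`A ∩ ℝ ⊂ (0, ∞)`, i.e. `ℍ ∖ A` keeps the whole negative half-line in its boundary and `A` stays away
from it) and of Werner's convention "`ℍ ∖ H₊` bounded and bounded away from the whole negative
half-line" (equivalent form: `isHullComplement_iff_disjoint_closure`). The body is VERBATIM the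
clause inlined in route SAWPoissonBanks (items stmt-CriticalPhenomena-4776…4779).
[cite: LawlerSchrammWerner2003Restriction, §2 (±-hulls 𝒬₊, 𝒬₋) and §8.1, transposed; Werner2005ConformalRestriction §4.1] -/
def IsHullComplement (D : DobrushinDomain) (j : Fin 2) (D' : DobrushinDomain) : Prop :=
  D'.carrier ⊆ D.carrier ∧ D'.pt 0 = D.pt 0 ∧ D'.pt 1 = D.pt 1 ∧ D.arc j ⊆ frontier D'.carrier ∧
    (∃ ε : ℝ, 0 < ε ∧ D'.carrier ∩ Metric.ball (D.pt 0) ε = D.carrier ∩ Metric.ball (D.pt 0) ε ∧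
      D'.carrier ∩ Metric.ball (D.pt 1) ε = D.carrier ∩ Metric.ball (D.pt 1) ε)

variable {D D' D'' : DobrushinDomain} {j k : Fin 2}

/-- Unfolding of `IsHullComplement` (by `Iff.rfl`: the definition is the inlined clause). [folklore] -/
theorem isHullComplement_iff : D.IsHullComplement j D' ↔
    D'.carrier ⊆ D.carrier ∧ D'.pt 0 = D.pt 0 ∧ D'.pt 1 = D.pt 1 ∧ D.arc j ⊆ frontier D'.carrier ∧
      (∃ ε : ℝ, 0 < ε ∧ D'.carrier ∩ Metric.ball (D.pt 0) ε = D.carrier ∩ Metric.ball (D.pt 0) ε ∧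
        D'.carrier ∩ Metric.ball (D.pt 1) ε = D.carrier ∩ Metric.ball (D.pt 1) ε) :=
  Iff.rfl

/-- A hull complement is a sub-domain. [folklore] -/
theorem IsHullComplement.carrier_subset (h : D.IsHullComplement j D') : D'.carrier ⊆ D.carrier :=
  h.1

/-- A hull complement has the same first marked point `a`. [folklore] -/
theorem IsHullComplement.pt_zero_eq (h : D.IsHullComplement j D') : D'.pt 0 = D.pt 0 :=
  h.2.1

/-- A hull complement has the same second marked point `b`. [folklore] -/
theorem IsHullComplement.pt_one_eq (h : D.IsHullComplement j D') : D'.pt 1 = D.pt 1 :=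
  h.2.2.1

/-- A hull complement has the same marked points. [folklore] -/
theorem IsHullComplement.pt_eq (h : D.IsHullComplement j D') (i : Fin 2) : D'.pt i = D.pt i := by
  fin_cases i
  exacts [h.pt_zero_eq, h.pt_one_eq]

/-- The kept arc lies in the frontier of the hull complement. [folklore] -/
theorem IsHullComplement.arc_subset_frontier (h : D.IsHullComplement j D') :
    D.arc j ⊆ frontier D'.carrier :=
  h.2.2.2.1

/-- A hull complement agrees with the domain in small balls about the marked points. [folklore] -/
theorem IsHullComplement.exists_inter_ball_pt_eq (h : D.IsHullComplement j D') :
    ∃ ε : ℝ, 0 < ε ∧ D'.carrier ∩ ball (D.pt 0) ε = D.carrier ∩ ball (D.pt 0) ε ∧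
      D'.carrier ∩ ball (D.pt 1) ε = D.carrier ∩ ball (D.pt 1) ε :=
  h.2.2.2.2

/-- **Reflexivity** (empty hull): `D` is a hull complement of itself on either side. [folklore] -/
theorem isHullComplement_self (D : DobrushinDomain) (j : Fin 2) : D.IsHullComplement j D :=
  ⟨Subset.rfl, rfl, rfl, D.arc_subset_frontier j, 1, one_pos, rfl, rfl⟩

/-- **The kept arc is a boundary arc of the hull complement**: `D.arc j = D'.arc k` for some `k` (which
one depends on the loop orientations). The open arc `D.arc j ∖ {a, b}` is connected, lies in
`∂D' = D'.arc 0 ∪ D'.arc 1` and misses `D'.arc 0 ∩ D'.arc 1 = {a, b}`, so it lies in one `D'.arc k`;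
a sub-arc with the same endpoints is the whole arc. [folklore] -/
theorem IsHullComplement.exists_arc_eq (h : D.IsHullComplement j D') : ∃ k : Fin 2, D'.arc k = D.arc j := by
  set A₀ : Set ℂ := D.boundary '' Ioo (D.mark j) (D.nextMark j)
  have hA₀arc : A₀ ⊆ D.arc j := image_mono Ioo_subset_Icc_self
  have hA₀pt : ∀ z ∈ A₀, ∀ i : Fin 2, z ≠ D'.pt i := by
    rintro _ ⟨t, ht, rfl⟩ i
    rw [h.pt_eq i]
    exact D.boundary_ne_pt ht i
  have hcover : A₀ ⊆ D'.arc 0 ∪ D'.arc 1 := fun z hz => by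
    have hzf : z ∈ frontier D'.carrier := h.arc_subset_frontier (hA₀arc hz)
    rw [← (D'.iUnion_arc_holds : ⋃ i, D'.arc i = frontier D'.carrier)] at hzf
    obtain ⟨i, hi⟩ := mem_iUnion.1 hzf
    fin_cases i
    exacts [Or.inl hi, Or.inr hi]
  have hdisj : A₀ ∩ (D'.arc 0 ∩ D'.arc 1) = ∅ := by
    refine eq_empty_of_forall_notMem fun z ⟨hzA, hz0, hz1⟩ => ?_
    rcases D'.mem_arc_inter_arc (i := 0) (k := 1) (by decide) hz0 hz1 with e | e
    exacts [hA₀pt z hzA 0 e, hA₀pt z hzA (0 + 1) e]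
  obtain ⟨k, hk⟩ : ∃ k : Fin 2, A₀ ⊆ D'.arc k := by
    rcases (isPreconnected_iff_subset_of_disjoint_closed.1
      (isPreconnected_Ioo.image _ D.continuous_boundary.continuousOn)) _ _ (D'.isClosed_arc 0)
      (D'.isClosed_arc 1) hcover hdisj with h0 | h1
    exacts [⟨0, h0⟩, ⟨1, h1⟩]
  have hjk : D.arc j ⊆ D'.arc k := by
    rintro _ ⟨t, ht, rfl⟩
    rcases ht.1.eq_or_lt with h1 | h1
    · rw [← h1, ← MarkedDomain.pt, ← h.pt_eq j]
      exact D'.pt_mem_arc j k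
    rcases ht.2.lt_or_eq with h2 | h2
    · exact hk ⟨t, ⟨h1, h2⟩, rfl⟩
    · rw [h2, D.boundary_nextMark, ← h.pt_eq (j + 1)]
      exact D'.pt_mem_arc (j + 1) k
  refine ⟨k, (D'.arc_subset_of_isPreconnected k
    (isPreconnected_Icc.image _ D.continuous_boundary.continuousOn) hjk ?_ ?_).antisymm hjk⟩
  · rw [h.pt_eq k]; exact D.pt_mem_arc k j
  · rw [h.pt_eq (k + 1)]; exact D.pt_mem_arc (k + 1) j

/-- **Local coincidence along the kept arc.** Every `z ∈ D.arc j` has a ball on which `D' = D`. At the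
endpoints this is the last clause of the definition; at an interior point `z`, near `z` the frontier
of `D'` is the arc `D.arc j = D'.arc k` (`exists_arc_eq`, `exists_pos_forall_mem_arc_of_dist_lt`),
which misses `D`, and by Newman's uniform local connectedness of `D` a point `x ∈ D` close to `z` is
joined to a point of `D'` by a connected subset of `D` near `z`, which misses `∂D'`, so `x ∈ D'`. [folklore] -/
theorem IsHullComplement.exists_inter_ball_eq (h : D.IsHullComplement j D') {z : ℂ} (hz : z ∈ D.arc j) :
    ∃ ρ : ℝ, 0 < ρ ∧ D'.carrier ∩ ball z ρ = D.carrier ∩ ball z ρ := by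
  obtain ⟨ε, hε, hb0, hb1⟩ := h.exists_inter_ball_pt_eq
  have hpt : ∀ i : Fin 2, ∃ ρ : ℝ, 0 < ρ ∧ D'.carrier ∩ ball (D.pt i) ρ = D.carrier ∩ ball (D.pt i) ρ :=
    Fin.forall_fin_two.2 ⟨⟨ε, hε, hb0⟩, ⟨ε, hε, hb1⟩⟩
  obtain ⟨t, ht, rfl⟩ := hz
  rcases ht.1.eq_or_lt with h1 | h1
  · rw [← h1]; exact hpt j
  rcases ht.2.lt_or_eq with h2 | h2
  swap
  · rw [h2, D.boundary_nextMark]; exact hpt (j + 1)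
  have hto : t ∈ Ioo (D.mark j) (D.nextMark j) := ⟨h1, h2⟩
  -- `z` is an interior point of the arc `D'.arc k = D.arc j`
  obtain ⟨k, hk⟩ := h.exists_arc_eq
  obtain ⟨s, hs, hsz⟩ : D.boundary t ∈ D'.arc k := hk ▸ mem_image_of_mem _ (Ioo_subset_Icc_self hto)
  have hso : s ∈ Ioo (D'.mark k) (D'.nextMark k) := by
    refine ⟨hs.1.lt_of_ne ?_, hs.2.lt_of_ne ?_⟩
    · rintro rfl
      exact D.boundary_ne_pt hto k (hsz.symm.trans (h.pt_eq k))
    · intro hsM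
      rw [hsM, D'.boundary_nextMark, h.pt_eq (k + 1)] at hsz
      exact D.boundary_ne_pt hto (k + 1) hsz.symm
  -- the frontier of `D'` near `z` is inside the kept arc; ULC of `D` at scale `r / 2`
  obtain ⟨r, hr, hrarc, -⟩ := D'.exists_pos_forall_mem_arc_of_dist_lt k hso
  rw [hsz] at hrarc
  obtain ⟨η, hη, hulc⟩ := D.uniformlyLocallyConnected (half_pos hr)
  set ρ : ℝ := min (η / 2) (r / 2)
  have hρpos : 0 < ρ := lt_min (half_pos hη) (half_pos hr)
  have hρη : ρ ≤ η / 2 := min_le_left _ _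
  have hρr : ρ ≤ r / 2 := min_le_right _ _
  have hzcl : D.boundary t ∈ closure D'.carrier :=
    frontier_subset_closure (h.arc_subset_frontier (mem_image_of_mem _ (Ioo_subset_Icc_self hto)))
  obtain ⟨y₀, hy₀, hy₀z⟩ := Metric.mem_closure_iff.1 hzcl ρ hρpos
  refine ⟨ρ, hρpos, subset_antisymm (inter_subset_inter_left _ h.carrier_subset) ?_⟩
  rintro x ⟨hxD, hxz⟩
  refine ⟨?_, hxz⟩
  have hxz' : dist x (D.boundary t) < ρ := mem_ball.1 hxz
  have hxy : dist x y₀ < η :=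
    calc dist x y₀ ≤ dist x (D.boundary t) + dist (D.boundary t) y₀ := dist_triangle _ _ _
      _ < η := by linarith
  obtain ⟨S, hS, hSpre, hxS, hyS⟩ := hulc x hxD y₀ (h.carrier_subset hy₀) hxy
  have hSf : Disjoint S (frontier D'.carrier) := Set.disjoint_left.2 fun w hwS hwf => by
    have hw := hS hwS
    have hwz : dist w (D.boundary t) < r :=
      calc dist w (D.boundary t) ≤ dist w x + dist x (D.boundary t) := dist_triangle _ _ _
        _ < r := by linarith [mem_ball.1 hw.2]
    exact Set.disjoint_left.1 D.disjoint_carrier_frontier hw.1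
      (D.arc_subset_frontier j (hk ▸ hrarc w hwf hwz))
  exact D'.subset_carrier_of_isPreconnected hSpre hSf ⟨y₀, hyS, hy₀⟩ hxS

/-- **Local-coincidence form**: `D' ⊆ D`, same marked points, and every point of the kept arc has a
ball on which `D' = D` (then such a point is in `closure D' ∖ D'`, and `a, b ∈ D.arc j`). [folklore] -/
theorem isHullComplement_iff_forall_exists_inter_ball_eq : D.IsHullComplement j D' ↔
    D'.carrier ⊆ D.carrier ∧ D'.pt 0 = D.pt 0 ∧ D'.pt 1 = D.pt 1 ∧
      ∀ z ∈ D.arc j, ∃ ρ : ℝ, 0 < ρ ∧ D'.carrier ∩ ball z ρ = D.carrier ∩ ball z ρ := by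
  refine ⟨fun h => ⟨h.carrier_subset, h.pt_zero_eq, h.pt_one_eq, fun z => h.exists_inter_ball_eq⟩,
    fun ⟨hsub, h0, h1, hloc⟩ => ⟨hsub, h0, h1, fun z hz => ?_, ?_⟩⟩
  · obtain ⟨ρ, hρ, heq⟩ := hloc z hz
    have hzD : z ∈ frontier D.carrier := D.arc_subset_frontier j hz
    rw [D.isOpen.frontier_eq] at hzD
    rw [D'.isOpen.frontier_eq]
    refine ⟨Metric.mem_closure_iff.2 fun δ hδ => ?_, fun hzD' => hzD.2 (hsub hzD')⟩
    obtain ⟨w, hw, hzw⟩ := Metric.mem_closure_iff.1 hzD.1 (min δ ρ) (lt_min hδ hρ)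
    have hw' : w ∈ D'.carrier ∩ ball z ρ := by
      rw [heq]; exact ⟨hw, mem_ball'.2 (hzw.trans_le (min_le_right _ _))⟩
    exact ⟨w, hw'.1, hzw.trans_le (min_le_left _ _)⟩
  · obtain ⟨ρ₀, hρ₀, e₀⟩ := hloc (D.pt 0) (D.pt_mem_arc 0 j)
    obtain ⟨ρ₁, hρ₁, e₁⟩ := hloc (D.pt 1) (D.pt_mem_arc 1 j)
    exact ⟨min ρ₀ ρ₁, lt_min hρ₀ hρ₁, inter_ball_eq_of_le e₀ (min_le_left _ _),
      inter_ball_eq_of_le e₁ (min_le_right _ _)⟩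

/-- **Werner's form** ("`ℍ ∖ H₊` is bounded and bounded away from the whole negative half-line",
transposed): `D' ⊆ D`, same marked points, and the closure of the removed part `D ∖ D'` misses the
kept arc `D.arc j` (which contains `a` and `b`). [cite: Werner2005ConformalRestriction, §4.1, transposed] -/
theorem isHullComplement_iff_disjoint_closure : D.IsHullComplement j D' ↔
    D'.carrier ⊆ D.carrier ∧ D'.pt 0 = D.pt 0 ∧ D'.pt 1 = D.pt 1 ∧
      Disjoint (closure (D.carrier \ D'.carrier)) (D.arc j) := by
  rw [isHullComplement_iff_forall_exists_inter_ball_eq, Set.disjoint_right]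
  refine and_congr_right fun hsub => and_congr_right fun _ => and_congr_right fun _ =>
    forall₂_congr fun z _ => ?_
  rw [Metric.mem_closure_iff, not_forall]
  refine exists_congr fun ρ => ?_
  rw [Classical.not_imp, not_exists]
  refine and_congr_right fun _ => ⟨fun heq w ⟨⟨hwD, hwD'⟩, hzw⟩ => hwD' ?_, fun hfar => ?_⟩
  · have : w ∈ D.carrier ∩ ball z ρ := ⟨hwD, mem_ball'.2 hzw⟩
    rw [← heq] at this
    exact this.1
  · refine subset_antisymm (inter_subset_inter_left _ hsub) fun w ⟨hwD, hw⟩ => ⟨?_, hw⟩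
    exact by_contra fun hwD' => hfar w ⟨⟨hwD, hwD'⟩, mem_ball'.1 hw⟩

/-- `closure (D ∖ D')` misses the kept arc. [cite: Werner2005ConformalRestriction, §4.1, transposed] -/
theorem IsHullComplement.disjoint_closure_diff_arc (h : D.IsHullComplement j D') :
    Disjoint (closure (D.carrier \ D'.carrier)) (D.arc j) :=
  (isHullComplement_iff_disjoint_closure.1 h).2.2.2

/-- **A hull complement is a hull subdomain**: `D' ⊆ D`, same marked points, `a, b ∉ closure (D ∖ D')`
— verbatim the body of `MarkedDomain.IsHullSubdomain D D'` (`ConformalRestrictionProofs`, the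
transposed `𝒬*` of Lawler–Schramm–Werner; not imported here), so `h.isHullSubdomain` can be used
wherever `D.IsHullSubdomain D'` is expected. [cite: LawlerSchrammWerner2003Restriction, §2 (𝒬₊ ⊆ 𝒬*), transposed] -/
theorem IsHullComplement.isHullSubdomain (h : D.IsHullComplement j D') :
    D'.carrier ⊆ D.carrier ∧ D'.pt 0 = D.pt 0 ∧ D'.pt 1 = D.pt 1 ∧
      D.pt 0 ∉ closure (D.carrier \ D'.carrier) ∧ D.pt 1 ∉ closure (D.carrier \ D'.carrier) :=
  ⟨h.carrier_subset, h.pt_zero_eq, h.pt_one_eq,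
    Set.disjoint_right.1 h.disjoint_closure_diff_arc (D.pt_mem_arc 0 j),
    Set.disjoint_right.1 h.disjoint_closure_diff_arc (D.pt_mem_arc 1 j)⟩

/-- Same carrier, same marked points (e.g. the same domain with its boundary loop parametrised the
other way round): a hull complement on both sides (`A = ∅`). [folklore] -/
theorem isHullComplement_of_carrier_eq (hc : D'.carrier = D.carrier) (h0 : D'.pt 0 = D.pt 0)
    (h1 : D'.pt 1 = D.pt 1) (j : Fin 2) : D.IsHullComplement j D' :=
  isHullComplement_iff_disjoint_closure.2 ⟨hc.le, h0, h1, by simp [hc]⟩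

/-- **Transitivity on the same side** (`𝒬₊` is a semigroup): a hull complement `D''` of `D'` on the
side `k` of `D'` carrying the kept arc (`D.arc j ⊆ D'.arc k`; such a `k` exists by `exists_arc_eq` and
need not equal `j`) is one of `D`. [cite: LawlerSchrammWerner2003Restriction, §2 (𝒬₊, 𝒬₋ are semigroups), transposed] -/
theorem IsHullComplement.trans (h₁ : D.IsHullComplement j D') (h₂ : D'.IsHullComplement k D'')
    (hjk : D.arc j ⊆ D'.arc k) : D.IsHullComplement j D'' := by
  obtain ⟨hsub₁, h0₁, h1₁, hloc₁⟩ := isHullComplement_iff_forall_exists_inter_ball_eq.1 h₁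
  obtain ⟨hsub₂, h0₂, h1₂, hloc₂⟩ := isHullComplement_iff_forall_exists_inter_ball_eq.1 h₂
  refine isHullComplement_iff_forall_exists_inter_ball_eq.2
    ⟨hsub₂.trans hsub₁, h0₂.trans h0₁, h1₂.trans h1₁, fun z hz => ?_⟩
  obtain ⟨ρ₁, hρ₁, e₁⟩ := hloc₁ z hz
  obtain ⟨ρ₂, hρ₂, e₂⟩ := hloc₂ z (hjk hz)
  refine ⟨min ρ₁ ρ₂, lt_min hρ₁ hρ₂, ?_⟩
  rw [inter_ball_eq_of_le e₂ (min_le_right _ _), inter_ball_eq_of_le e₁ (min_le_left _ _)]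

/-- **Images under plane homeomorphisms.** If `D'` is a hull complement of `D` on side `j`, so is
`φ(D')` of `φ(D)` (`MarkedDomain.map`) for every `φ : ℂ ≃ₜ ℂ` — e.g. `similarity c hc w`,
`Complex.conjLIE.toHomeomorph` (images commute with frontiers; `φ(B(a, ε)) ∈ 𝓝 (φ a)`). [folklore] -/
theorem IsHullComplement.map (h : D.IsHullComplement j D') (φ : ℂ ≃ₜ ℂ) :
    IsHullComplement (D.map φ) j (D'.map φ) := by
  obtain ⟨hsub, h0, h1, harc, ε, hε, hb0, hb1⟩ := h
  refine ⟨image_mono hsub, by rw [MarkedDomain.pt_map, MarkedDomain.pt_map, h0],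
    by rw [MarkedDomain.pt_map, MarkedDomain.pt_map, h1], ?_, ?_⟩
  · rw [MarkedDomain.arc_map, MarkedDomain.carrier_map, ← φ.image_frontier]
    exact image_mono harc
  · simp only [MarkedDomain.carrier_map, MarkedDomain.pt_map]
    have key : ∀ i : Fin 2, D'.carrier ∩ ball (D.pt i) ε = D.carrier ∩ ball (D.pt i) ε →
        ∃ ε' : ℝ, 0 < ε' ∧
          φ '' D'.carrier ∩ ball (φ (D.pt i)) ε' = φ '' D.carrier ∩ ball (φ (D.pt i)) ε' := by
      intro i hi
      obtain ⟨ε', hε', hball⟩ := Metric.isOpen_iff.1 (φ.isOpenMap _ isOpen_ball) (φ (D.pt i))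
        (mem_image_of_mem φ (mem_ball_self hε))
      refine ⟨ε', hε', inter_eq_inter_of_subset ?_ hball⟩
      rw [← image_inter φ.injective, ← image_inter φ.injective, hi]
    obtain ⟨ε₀, hε₀, he₀⟩ := key 0 hb0
    obtain ⟨ε₁, hε₁, he₁⟩ := key 1 hb1
    exact ⟨min ε₀ ε₁, lt_min hε₀ hε₁, inter_ball_eq_of_le he₀ (min_le_left _ _),
      inter_ball_eq_of_le he₁ (min_le_right _ _)⟩

/-- **Meet on the same side.** If `D'`, `D''` are hull complements of `D` on side `j` and `E` is a
Dobrushin domain with carrier `D' ∩ D''` and the marked points of `D`, then so is `E` (local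
coincidence on the smaller ball): the semilattice of same-side hulls for capacity functionals. [folklore] -/
theorem IsHullComplement.inter (h₁ : D.IsHullComplement j D') (h₂ : D.IsHullComplement j D'')
    {E : DobrushinDomain} (hE : E.carrier = D'.carrier ∩ D''.carrier) (hE0 : E.pt 0 = D.pt 0)
    (hE1 : E.pt 1 = D.pt 1) : D.IsHullComplement j E := by
  obtain ⟨hsub₁, -, -, hloc₁⟩ := isHullComplement_iff_forall_exists_inter_ball_eq.1 h₁
  obtain ⟨-, -, -, hloc₂⟩ := isHullComplement_iff_forall_exists_inter_ball_eq.1 h₂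
  refine isHullComplement_iff_forall_exists_inter_ball_eq.2
    ⟨by rw [hE]; exact inter_subset_left.trans hsub₁, hE0, hE1, fun z hz => ?_⟩
  obtain ⟨ρ₁, hρ₁, e₁⟩ := hloc₁ z hz
  obtain ⟨ρ₂, hρ₂, e₂⟩ := hloc₂ z hz
  refine ⟨min ρ₁ ρ₂, lt_min hρ₁ hρ₂, ?_⟩
  rw [hE, inter_assoc, inter_ball_eq_of_le e₂ (min_le_right _ _), inter_left_comm,
    inter_ball_eq_of_le e₁ (min_le_left _ _), ← inter_assoc, inter_self]

end DobrushinDomain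

end Literature.Probability.RandomPlanarGeometry
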